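import Summits.QuantumFields.YangMills.Theorems.BalabanUVNodesN18U3LettersOfLocalTermsPackage
import Literature.MathematicalPhysics.QuantumFieldTheory.Balaban1983to89.B16Exp198TwoRun

/-!
# BalabanUVNodes ∕ N18 (node U3's kernel objects) — THE TERM-DATA PACKAGE, GENERIC EDITION: W1-19b's four letters for W1-20's localized sum `localizedSum F S emb` read through ANY
# representation `ρ` and colour basis `bV` on the window `]0, γ]^ℕ` — `GeometricIncrements … r_inc` (`r_inc < 1`), `PolLimitsExist`, `WindowedStepRate … 1 …`, `KernelStepRate` — from
# ONE term-data list (chart data or single-run analyticity, the local stability RATE, the two-run holomorphic data); the law-free edition MODEL inhabitants consume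
# (Track A, DAG node N18 = NE5 ∕ node U3's letters; key K3⁸ `SpineGivenEndpointR13SepCoPHV` = stmt-QuantumFields-27366; cell `pub-ymgap`, WIDTH SEAT `pub-ymgap-dag-n18-w2` g10,
# FILE 3; `--kind proof --supports stmt-QuantumFields-27366 --as helper`, COUNT-NEUTRAL; THEOREMS ONLY, 0 `def`, 0 `sorry`)

WHY.  PART 1 (`…N18U3LettersOfLocalTermsPackage`) states the package AT THE RECORD, under W1-20's law `Localizes17OfRecord₁₃` — whose inhabitant is Bałaban's cluster expansion and
nothing else.  A MODEL inhabitant (dag-n22-w3's non-degenerate model towers, this seat's g6∕g7 on-site families, any future A6 witness of the term-data list) lives one level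
down: a family of towers `S`, reading maps `emb`, a representation `ρ : V →L[ℝ] 𝔄`, a basis `bV`, a window radius `γ` — W1-19b's GENERIC letters `GeometricIncrements ∕
PolLimitsExist ∕ WindowedStepRate ∕ KernelStepRate F (localizedSum F S emb) ρ bV …`.  THIS FILE is PART 1 §2∕§3 in that currency: g9 FILE 7's
`geometricIncrements_localizedSum_of_localStabilityRate`, g6's `polLimitsExist_of_geometricIncrements` ∕ `kernelStepRate_of_geometricIncrements_of_windowed` (`s := 1`), g9 FILE 4's
`windowedStepRate_localizedSum_one_of_holomorphicTwoRun`, and PART 1 §1b's analyticity ⇒ `hC ∧ hval`, composed once.  The record editions of PART 1 are these at `(θ.ρ8, θ.bV, θ.γ)`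
behind def-W1's `…_iff_of_localizes` faces.

WHAT (`M = L^{m′}`, ONE `(κ, δ₀)`, `δ₁ = delta1 δ₀ κ (4M)`, `C₅′ = (16M₀B₃²∕r²)e^{12Mδ₁}K₀(64,8)K₁(4,δ₀∕2)`, `r_inc = max{ω^{1∕2}, e^{−ηc}}`): ★★ `u3Letters_localizedSum_of_localTermData`
(chart-data edition) · ★★ `u3Letters_localizedSum_of_analyticLocalTermData` (analytic edition) — both conclude
`r_inc < 1 ∧ GeometricIncrements F (localizedSum F S emb) ρ bV (Window γ) r_inc ∧ PolLimitsExist … (Window γ) ∧ WindowedStepRate … γ 1 δ₁ θ (C₅′θ) ∧ KernelStepRate … γ δ₁ θ C₅′`.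
A6 SMOKE (joint satisfiability of the ≈ 25 displayed binders): `polScalar_eq_zero_of_forall_eq_zero` · `clusterStep_E_eq_zero_of_idx_empty` (a cluster step WITHOUT TERMS has
`E^{(k+1)}(X) = 0`: `B16Exp198TwoRun.truncatedWeight_zero`) · ★ `u3Letters_localizedSum_of_analyticLocalTermData_fires_emptyTowers` (the analytic package FIRES at every family of
towers with `idx ≡ ∅`, ANY complexified space `Ec`, `ι = G = G_B = G_A := 0`, `E₀ = B₃ = M₀ = A := 0` — degenerate, declared; certifies only that no antecedent is vacuous).

HONEST FRAMING — what this is NOT.  Count-neutral composition; NO estimate of Bałaban's proved or asserted — the chart data ∕ analytic representations, the local stability rate and the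
TERM-LEVEL TWO-RUN SUP BOUND (node N18's content, NOT PRINTED for d = 4) are DISPLAYED hypotheses; no model inhabitant is built here; no letter OF RECORD inhabited; N18 ∕ N22 ∕ (D4)
NOT discharged; K3⁸ OPEN, not claimed; counts UNMOVED (typed 28∕28 · discharged 5∕27 (A 5∕28)); R4 closes the conditional finite-𝕋⁴ rung `BalabanLadder.UV` only — NOT ℝ⁴, NOT
infinite volume, NOT OS, NOT a mass gap; the Clay problem is NOT proved by any of this.

References (TYPES only): [I] = [Balaban1987RG1] Thm 1 p. 259, (1.7) p. 261, (1.18) p. 263, (1.20)–(1.21) p. 264, (4.35)–(4.37) pp. 290–291, (5.10) p. 293; [II] =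
[Balaban1988RG2Cluster] (2.13)–(2.14) pp. 14–15; [King1986] (3.73) p. 665.  Imports PART 1 BY NAME; nothing re-declared.
-/

noncomputable section

namespace YMDAG.N18.U3LettersPackage

open Filter Metric Set
open scoped BigOperators Topology
open Literature.MathematicalPhysics.QuantumFieldTheory.Balaban1983to89
open Literature.MathematicalPhysics.QuantumFieldTheory.Balaban1983to89.T4Continuum (T4Family)
open Literature.MathematicalPhysics.QuantumFieldTheory.Balaban1983to89.FlowStep (Box)
open Literature.MathematicalPhysics.QuantumFieldTheory.Balaban1983to89.B12PolarizationTensor120 (polComp expChart)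
open Literature.MathematicalPhysics.QuantumFieldTheory.Balaban1983to89.Node00 (polScalar siteOfInt)
open Literature.MathematicalPhysics.QuantumFieldTheory.Balaban1983to89.Node00.U3OfKernels (histPrefix)
open Literature.MathematicalPhysics.QuantumFieldTheory.Balaban1983to89.Node00.U3KernelLetters (PolLimitsExist GeometricIncrements WindowedStepRate KernelStepRate)
open Literature.MathematicalPhysics.QuantumFieldTheory.Balaban1983to89.Node00.LocalizedSum17 (localizedSum ReadingMaps)
open Literature.MathematicalPhysics.QuantumFieldTheory.Balaban1983to89.Node00.Sect2 (domSys domCount CPair)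
open Literature.MathematicalPhysics.QuantumFieldTheory.Balaban1983to89.Node00.W1 (ClusterTower castDom domSys_succ)
open Literature.MathematicalPhysics.QuantumFieldTheory.Balaban1983to89.T4LevelShift (siteShift)
open Literature.MathematicalPhysics.QuantumFieldTheory.Balaban1983to89.T4OutputRate (Window)
open Literature.MathematicalPhysics.QuantumFieldTheory.Balaban1983to89.B12Decay510 (delta1)
open Literature.MathematicalPhysics.QuantumFieldTheory.Balaban1983to89.B12Decay510Window (K₁)
open Literature.MathematicalPhysics.QuantumFieldTheory.Balaban1983to89.B12Decay510Torus (distCT nearT)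
open Literature.MathematicalPhysics.QuantumFieldTheory.Balaban1983to89.B12TreeDecay (K₀ kappa₀)
open Literature.MathematicalPhysics.QuantumFieldTheory.Balaban1983to89.TreeLengthTorus (TPt torusTreeLen)
open YMDAG.N18.TwoRunWindowLevelShift (ladder)
open YMDAG.N18.GeometricIncrementsOfLocalTerms (geometricIncrements_localizedSum_of_localStabilityRate twoScaleRate_lt_one)
open YMDAG.N18.RunDifferenceOfLocalTerms (windowedStepRate_localizedSum_one_of_holomorphicTwoRun)
open YMDAG.N18.PolLimitRate (polLimitsExist_of_geometricIncrements kernelStepRate_of_geometricIncrements_of_windowed)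

section Generic

variable {Ec : Type*} [NormedAddCommGroup Ec] [NormedSpace ℂ Ec]
variable {𝔄 : Type*} [NormedRing 𝔄] [NormedAlgebra ℝ 𝔄] {V : Type*} [NormedAddCommGroup V] [NormedSpace ℝ V] {ι : Type*} [Fintype ι] {𝔸 : Type*}
variable (F : T4Family) (m' : ℕ) (M : ℕ) [NeZero M] (hM : M = F.L ^ m')
variable (S : (K : ℕ) → ClusterTower (F.P K) 𝔸 M) (emb : ReadingMaps F 𝔄 𝔸) (ρ : V →L[ℝ] 𝔄) (bV : Module.Basis ι ℝ V)

include hM in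
open Classical in
/-- ★★ **W1-19b's FOUR LETTERS FOR THE LOCALIZED SUM FROM ONE TERM-DATA PACKAGE** (generic, chart-data edition; `M = L^{m′}`, ONE `(κ, δ₀)` with `κ, δ₀ > 0`, `κ∕4 ≥ κ₀(64,8)`).
GIVEN, for `localizedSum F S emb` read through `(ρ, bV)` on the window `]0, γ]^ℕ`: (i) `C²` charts, (ii) K-uniform soft value majorants, (iii) the local stability RATE
(`a ≥ 0`, `0 < ω < 1`; DISPLAYED), (iv) the two-run holomorphic data of road (A) with the TERM-LEVEL SUP BOUND `‖G_B − G_A‖ ≤ M₀θ^{k+1}e^{−κd(X)}` (DISPLAYED, NOT PRINTED for d = 4)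
⇒ `r_inc < 1 ∧ GeometricIncrements … (Window γ) r_inc ∧ PolLimitsExist … (Window γ) ∧ WindowedStepRate … γ 1 δ₁ θ (C₅′θ) ∧ KernelStepRate … γ δ₁ θ C₅′` (g9 FILE 7 · g6 · g9 FILE 4 ·
g6 at `s := 1`); (1.21)-existence is NOT an input.
[cite: Balaban1987RG1, Thm 1 p.259, (1.7) p.261, (1.18) p.263, (1.20)-(1.21) p.264, (4.35)-(4.36) p.290, (4.37) p.291 and (5.10) p.293; Balaban1988RG2Cluster, (2.13)-(2.14) pp.14-15; King1986, (3.73) p.665] -/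
theorem u3Letters_localizedSum_of_localTermData {γ κ δ₀ a ω : ℝ} (hκ0 : 0 < κ) (hδ₀ : 0 < δ₀) (hκ : kappa₀ (4 * 2 ^ 4) (2 * 4) ≤ κ / 2 / 2) (ha : 0 ≤ a)
    (hω : 0 < ω) (hω1 : ω < 1)
    (hC : ∀ g ∈ Window γ, ∀ (k K : ℕ) (X : (domSys (F.P K) M (k + 1)).Dom), ContDiffAt ℝ 2 (expChart (fun W' => (((S K) k).E (histPrefix g k) (emb K k W') X).re) ρ) 0)
    (hval : ∀ g ∈ Window γ, ∀ (k : ℕ) (μ ν : Fin 4) (z : Fin 4 → ℤ), ∃ CE : ℝ, 0 ≤ CE ∧ ∀ (K : ℕ) (X : (domSys (F.P K) M (k + 1)).Dom) (c : ι),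
      let e : Site (F.P K) (k + 1) → TPt 4 (domCount (F.P K) M (k + 1) * M) := fun x i => (ZMod.cast (x i) : ZMod (domCount (F.P K) M (k + 1) * M))
      |polComp ℝ (expChart (fun W' => (((S K) k).E (histPrefix g k) (emb K k W') X).re) ρ) bV (Fin.cast (F.P_d K).symm μ) (siteOfInt F K (k + 1) z) c
          (Fin.cast (F.P_d K).symm ν) (siteOfInt F K (k + 1) 0) c| ≤
        CE * Real.exp (-κ * torusTreeLen X.1) * Real.exp (-δ₀ * distCT (domCount (F.P K) M (k + 1)) M (e (siteOfInt F K (k + 1) z)) (nearT (M := M) (e (siteOfInt F K (k + 1) z)) X)) *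
          Real.exp (-δ₀ * distCT (domCount (F.P K) M (k + 1)) M (e (siteOfInt F K (k + 1) 0)) (nearT (M := M) (e (siteOfInt F K (k + 1) 0)) X)))
    (hstab : ∀ g ∈ Window γ, ∀ (k : ℕ) (μ ν : Fin 4) (z : Fin 4 → ℤ), ∃ (Ks : ℕ) (A : ℝ), 0 ≤ A ∧ ∀ R : ℝ, 0 ≤ R → ∀ K, Ks ≤ K →
      |(∑ X ∈ Finset.univ.filter (fun X : (domSys (F.P (K + 1)) M (k + 1)).Dom =>
          ¬ (R < torusTreeLen X.1 ∨ R < distCT (domCount (F.P (K + 1)) M (k + 1)) M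
            (fun i : Fin 4 => (ZMod.cast (siteOfInt F (K + 1) (k + 1) 0 i) : ZMod (domCount (F.P (K + 1)) M (k + 1) * M)))
            (nearT (M := M) (fun i : Fin 4 => (ZMod.cast (siteOfInt F (K + 1) (k + 1) 0 i) : ZMod (domCount (F.P (K + 1)) M (k + 1) * M))) X))),
          polScalar (fun W' => (((S (K + 1)) k).E (histPrefix g k) (emb (K + 1) k W') X).re) ρ bV (Fin.cast (F.P_d (K + 1)).symm μ) (siteOfInt F (K + 1) (k + 1) z)
            (Fin.cast (F.P_d (K + 1)).symm ν) (siteOfInt F (K + 1) (k + 1) 0)) -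
        (∑ X ∈ Finset.univ.filter (fun X : (domSys (F.P K) M (k + 1)).Dom =>
          ¬ (R < torusTreeLen X.1 ∨ R < distCT (domCount (F.P K) M (k + 1)) M
            (fun i : Fin 4 => (ZMod.cast (siteOfInt F K (k + 1) 0 i) : ZMod (domCount (F.P K) M (k + 1) * M)))
            (nearT (M := M) (fun i : Fin 4 => (ZMod.cast (siteOfInt F K (k + 1) 0 i) : ZMod (domCount (F.P K) M (k + 1) * M))) X))),
          polScalar (fun W' => (((S K) k).E (histPrefix g k) (emb K k W') X).re) ρ bV (Fin.cast (F.P_d K).symm μ) (siteOfInt F K (k + 1) z)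
            (Fin.cast (F.P_d K).symm ν) (siteOfInt F K (k + 1) 0))| ≤ A * Real.exp (a * R) * ω ^ K)
    {θ r M₀ B₃ : ℝ} (hθ : 0 ≤ θ) (hr : 0 < r) (hM₀ : 0 ≤ M₀) (hB₃ : 0 ≤ B₃)
    (ιc : (k : ℕ) → (Fin (k + 2) → ℝ) → (K : ℕ) → (domSys (F.P (K + 1)) M (k + 1 + 1)).Dom → ((Fin (F.P (K + 1)).d → Site (F.P (K + 1)) (k + 1 + 1) → V) →L[ℝ] Ec))
    (GB GA : (k : ℕ) → (Fin (k + 2) → ℝ) → (K : ℕ) → (domSys (F.P (K + 1)) M (k + 1 + 1)).Dom → Ec → ℂ)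
    (U : (k : ℕ) → (Fin (k + 2) → ℝ) → (K : ℕ) → (domSys (F.P (K + 1)) M (k + 1 + 1)).Dom → Set Ec) (hU : ∀ k w K X, IsOpen (U k w K X))
    (hGB : ∀ k w K X, DifferentiableOn ℂ (GB k w K X) (U k w K X)) (hGA : ∀ k w K X, DifferentiableOn ℂ (GA k w K X) (U k w K X))
    (hrU : ∀ k w K X, ball (0 : Ec) r ⊆ U k w K X)
    (hfB : ∀ (k : ℕ) (w : Fin (k + 2) → ℝ), w ∈ Box γ (k + 1) → ∀ (K : ℕ) (X : (domSys (F.P (K + 1)) M (k + 1 + 1)).Dom) (B),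
      expChart (fun W' => (((S (K + 1)) (k + 1)).E w (emb (K + 1) (k + 1) W') X).re) ρ B = (GB k w K X (ιc k w K X B)).re)
    (hfA : ∀ (k : ℕ) (w : Fin (k + 2) → ℝ), w ∈ Box γ (k + 1) → ∀ (K : ℕ) (X : (domSys (F.P (K + 1)) M (k + 1 + 1)).Dom) (B),
      expChart (fun W' : Fin (F.P (K + 1)).d → Site (F.P (K + 1)) (k + 1 + 1) → 𝔄 =>
        (((S K) k).E (Fin.tail w) (emb K k (fun κ' y => W' κ' (siteShift (ladder F K k) y))) (castDom (domSys_succ F M K (k + 1)) X)).re) ρ B = (GA k w K X (ιc k w K X B)).re)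
    (hsup : ∀ (k : ℕ) (w : Fin (k + 2) → ℝ), w ∈ Box γ (k + 1) → ∀ (K : ℕ) (X : (domSys (F.P (K + 1)) M (k + 1 + 1)).Dom), ∀ ζ ∈ ball (0 : Ec) r,
      ‖GB k w K X ζ - GA k w K X ζ‖ ≤ M₀ * θ ^ (k + 1) * Real.exp (-κ * torusTreeLen X.1))
    (htail : ∀ (k : ℕ) (w : Fin (k + 2) → ℝ) (K : ℕ) (X : (domSys (F.P (K + 1)) M (k + 1 + 1)).Dom) (l : Fin (F.P (K + 1)).d) (t : Site (F.P (K + 1)) (k + 1 + 1)) (c : ι),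
      let e : Site (F.P (K + 1)) (k + 1 + 1) → TPt 4 (domCount (F.P (K + 1)) M (k + 1 + 1) * M) :=
        fun x i => (ZMod.cast (x i) : ZMod (domCount (F.P (K + 1)) M (k + 1 + 1) * M))
      ‖ιc k w K X (Pi.single l (Pi.single t (bV c)))‖ ≤ B₃ * Real.exp (-δ₀ * distCT (domCount (F.P (K + 1)) M (k + 1 + 1)) M (e t) (nearT (M := M) (e t) X))) :
    max (Real.exp (Real.log ω / 2)) (Real.exp (-(min κ δ₀ / 2) * (-Real.log ω / (2 * (a + 1))))) < 1 ∧
    GeometricIncrements F (localizedSum F S emb) ρ bV (Window γ) (max (Real.exp (Real.log ω / 2)) (Real.exp (-(min κ δ₀ / 2) * (-Real.log ω / (2 * (a + 1)))))) ∧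
    PolLimitsExist F (localizedSum F S emb) ρ bV (Window γ) ∧
    WindowedStepRate F (localizedSum F S emb) ρ bV γ 1 (delta1 δ₀ κ ((M : ℝ) * 4)) θ
      (16 * M₀ * B₃ ^ 2 / r ^ 2 * Real.exp (delta1 δ₀ κ ((M : ℝ) * 4) * ((M : ℝ) * 4) * 3) * K₀ (4 * 2 ^ 4) (2 * 4) * K₁ 4 (δ₀ / 2) * θ) ∧
    KernelStepRate F (localizedSum F S emb) ρ bV γ (delta1 δ₀ κ ((M : ℝ) * 4)) θ
      (16 * M₀ * B₃ ^ 2 / r ^ 2 * Real.exp (delta1 δ₀ κ ((M : ℝ) * 4) * ((M : ℝ) * 4) * 3) * K₀ (4 * 2 ^ 4) (2 * 4) * K₁ 4 (δ₀ / 2)) := by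
  have hinc := geometricIncrements_localizedSum_of_localStabilityRate F m' M hM S emb ρ bV (Window γ) hκ0 hδ₀ hκ ha hω hω1 hC hval hstab
  have hη : 0 < min κ δ₀ / 2 := by have := lt_min hκ0 hδ₀; linarith
  have hrr := twoScaleRate_lt_one hη ha hω hω1
  have hκ2 : kappa₀ (4 * 2 ^ 4) (2 * 4) ≤ κ / 2 := hκ.trans (by linarith)
  have hS := windowedStepRate_localizedSum_one_of_holomorphicTwoRun F m' M hM S emb ρ bV hθ hr hM₀ hB₃ hδ₀ hκ2 ιc GB GA U hU hGB hGA hrU hfB hfA hsup htail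
  exact ⟨hrr, hinc, polLimitsExist_of_geometricIncrements F _ ρ bV hrr hinc, hS, kernelStepRate_of_geometricIncrements_of_windowed F ρ bV 1 hrr hinc hS⟩

include hM in
open Classical in
/-- ★★ **W1-19b's FOUR LETTERS FOR THE LOCALIZED SUM — GENERIC, ANALYTIC EDITION**: the same with PART 1 §1b's single-run analytic input (per `(g ∈ Window γ, k, K, X)`: `ι` with the
(4.35) tails, `G` holomorphic on `U ⊇ ball 0 r`, `expChart(term) ρ = Re G ∘ ι`, `‖G‖ ≤ E₀e^{−κd(X)}` on the ball) in place of `hC ∕ hval`; ONE `(κ, δ₀, r, B₃)`.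
[cite: Balaban1987RG1, Thm 1 p.259, (1.7) p.261, (1.18) p.263, (1.20)-(1.21) p.264, (4.35)-(4.36) p.290, (4.37) p.291 and (5.10) p.293; Balaban1988RG2Cluster, (2.13)-(2.14) pp.14-15; King1986, (3.73) p.665] -/
theorem u3Letters_localizedSum_of_analyticLocalTermData {γ κ δ₀ a ω r E₀ B₃ : ℝ} (hκ0 : 0 < κ) (hδ₀ : 0 < δ₀) (hκ : kappa₀ (4 * 2 ^ 4) (2 * 4) ≤ κ / 2 / 2)
    (ha : 0 ≤ a) (hω : 0 < ω) (hω1 : ω < 1) (hr : 0 < r) (hE₀ : 0 ≤ E₀) (hB₃ : 0 ≤ B₃)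
    (ι₁ : (g : ℕ → ℝ) → (k K : ℕ) → (domSys (F.P K) M (k + 1)).Dom → ((Fin (F.P K).d → Site (F.P K) (k + 1) → V) →L[ℝ] Ec))
    (G₁ : (g : ℕ → ℝ) → (k K : ℕ) → (domSys (F.P K) M (k + 1)).Dom → Ec → ℂ)
    (U₁ : (g : ℕ → ℝ) → (k K : ℕ) → (domSys (F.P K) M (k + 1)).Dom → Set Ec) (hU₁ : ∀ g k K X, IsOpen (U₁ g k K X))
    (hG₁ : ∀ g k K X, DifferentiableOn ℂ (G₁ g k K X) (U₁ g k K X)) (hrU₁ : ∀ g k K X, ball (0 : Ec) r ⊆ U₁ g k K X)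
    (hf₁ : ∀ g ∈ Window γ, ∀ (k K : ℕ) (X : (domSys (F.P K) M (k + 1)).Dom) (B : Fin (F.P K).d → Site (F.P K) (k + 1) → V),
      expChart (fun W' => (((S K) k).E (histPrefix g k) (emb K k W') X).re) ρ B = (G₁ g k K X (ι₁ g k K X B)).re)
    (hsup₁ : ∀ g ∈ Window γ, ∀ (k K : ℕ) (X : (domSys (F.P K) M (k + 1)).Dom), ∀ ζ ∈ ball (0 : Ec) r, ‖G₁ g k K X ζ‖ ≤ E₀ * Real.exp (-κ * torusTreeLen X.1))
    (htail₁ : ∀ (g : ℕ → ℝ) (k K : ℕ) (X : (domSys (F.P K) M (k + 1)).Dom) (l : Fin (F.P K).d) (t : Site (F.P K) (k + 1)) (c : ι),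
      let e : Site (F.P K) (k + 1) → TPt 4 (domCount (F.P K) M (k + 1) * M) := fun x i => (ZMod.cast (x i) : ZMod (domCount (F.P K) M (k + 1) * M))
      ‖ι₁ g k K X (Pi.single l (Pi.single t (bV c)))‖ ≤ B₃ * Real.exp (-δ₀ * distCT (domCount (F.P K) M (k + 1)) M (e t) (nearT (M := M) (e t) X)))
    (hstab : ∀ g ∈ Window γ, ∀ (k : ℕ) (μ ν : Fin 4) (z : Fin 4 → ℤ), ∃ (Ks : ℕ) (A : ℝ), 0 ≤ A ∧ ∀ R : ℝ, 0 ≤ R → ∀ K, Ks ≤ K →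
      |(∑ X ∈ Finset.univ.filter (fun X : (domSys (F.P (K + 1)) M (k + 1)).Dom =>
          ¬ (R < torusTreeLen X.1 ∨ R < distCT (domCount (F.P (K + 1)) M (k + 1)) M
            (fun i : Fin 4 => (ZMod.cast (siteOfInt F (K + 1) (k + 1) 0 i) : ZMod (domCount (F.P (K + 1)) M (k + 1) * M)))
            (nearT (M := M) (fun i : Fin 4 => (ZMod.cast (siteOfInt F (K + 1) (k + 1) 0 i) : ZMod (domCount (F.P (K + 1)) M (k + 1) * M))) X))),
          polScalar (fun W' => (((S (K + 1)) k).E (histPrefix g k) (emb (K + 1) k W') X).re) ρ bV (Fin.cast (F.P_d (K + 1)).symm μ) (siteOfInt F (K + 1) (k + 1) z)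
            (Fin.cast (F.P_d (K + 1)).symm ν) (siteOfInt F (K + 1) (k + 1) 0)) -
        (∑ X ∈ Finset.univ.filter (fun X : (domSys (F.P K) M (k + 1)).Dom =>
          ¬ (R < torusTreeLen X.1 ∨ R < distCT (domCount (F.P K) M (k + 1)) M
            (fun i : Fin 4 => (ZMod.cast (siteOfInt F K (k + 1) 0 i) : ZMod (domCount (F.P K) M (k + 1) * M)))
            (nearT (M := M) (fun i : Fin 4 => (ZMod.cast (siteOfInt F K (k + 1) 0 i) : ZMod (domCount (F.P K) M (k + 1) * M))) X))),
          polScalar (fun W' => (((S K) k).E (histPrefix g k) (emb K k W') X).re) ρ bV (Fin.cast (F.P_d K).symm μ) (siteOfInt F K (k + 1) z)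
            (Fin.cast (F.P_d K).symm ν) (siteOfInt F K (k + 1) 0))| ≤ A * Real.exp (a * R) * ω ^ K)
    {θ M₀ : ℝ} (hθ : 0 ≤ θ) (hM₀ : 0 ≤ M₀)
    (ιc : (k : ℕ) → (Fin (k + 2) → ℝ) → (K : ℕ) → (domSys (F.P (K + 1)) M (k + 1 + 1)).Dom → ((Fin (F.P (K + 1)).d → Site (F.P (K + 1)) (k + 1 + 1) → V) →L[ℝ] Ec))
    (GB GA : (k : ℕ) → (Fin (k + 2) → ℝ) → (K : ℕ) → (domSys (F.P (K + 1)) M (k + 1 + 1)).Dom → Ec → ℂ)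
    (U : (k : ℕ) → (Fin (k + 2) → ℝ) → (K : ℕ) → (domSys (F.P (K + 1)) M (k + 1 + 1)).Dom → Set Ec) (hU : ∀ k w K X, IsOpen (U k w K X))
    (hGB : ∀ k w K X, DifferentiableOn ℂ (GB k w K X) (U k w K X)) (hGA : ∀ k w K X, DifferentiableOn ℂ (GA k w K X) (U k w K X))
    (hrU : ∀ k w K X, ball (0 : Ec) r ⊆ U k w K X)
    (hfB : ∀ (k : ℕ) (w : Fin (k + 2) → ℝ), w ∈ Box γ (k + 1) → ∀ (K : ℕ) (X : (domSys (F.P (K + 1)) M (k + 1 + 1)).Dom) (B),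
      expChart (fun W' => (((S (K + 1)) (k + 1)).E w (emb (K + 1) (k + 1) W') X).re) ρ B = (GB k w K X (ιc k w K X B)).re)
    (hfA : ∀ (k : ℕ) (w : Fin (k + 2) → ℝ), w ∈ Box γ (k + 1) → ∀ (K : ℕ) (X : (domSys (F.P (K + 1)) M (k + 1 + 1)).Dom) (B),
      expChart (fun W' : Fin (F.P (K + 1)).d → Site (F.P (K + 1)) (k + 1 + 1) → 𝔄 =>
        (((S K) k).E (Fin.tail w) (emb K k (fun κ' y => W' κ' (siteShift (ladder F K k) y))) (castDom (domSys_succ F M K (k + 1)) X)).re) ρ B = (GA k w K X (ιc k w K X B)).re)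
    (hsup : ∀ (k : ℕ) (w : Fin (k + 2) → ℝ), w ∈ Box γ (k + 1) → ∀ (K : ℕ) (X : (domSys (F.P (K + 1)) M (k + 1 + 1)).Dom), ∀ ζ ∈ ball (0 : Ec) r,
      ‖GB k w K X ζ - GA k w K X ζ‖ ≤ M₀ * θ ^ (k + 1) * Real.exp (-κ * torusTreeLen X.1))
    (htail : ∀ (k : ℕ) (w : Fin (k + 2) → ℝ) (K : ℕ) (X : (domSys (F.P (K + 1)) M (k + 1 + 1)).Dom) (l : Fin (F.P (K + 1)).d) (t : Site (F.P (K + 1)) (k + 1 + 1)) (c : ι),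
      let e : Site (F.P (K + 1)) (k + 1 + 1) → TPt 4 (domCount (F.P (K + 1)) M (k + 1 + 1) * M) :=
        fun x i => (ZMod.cast (x i) : ZMod (domCount (F.P (K + 1)) M (k + 1 + 1) * M))
      ‖ιc k w K X (Pi.single l (Pi.single t (bV c)))‖ ≤ B₃ * Real.exp (-δ₀ * distCT (domCount (F.P (K + 1)) M (k + 1 + 1)) M (e t) (nearT (M := M) (e t) X))) :
    max (Real.exp (Real.log ω / 2)) (Real.exp (-(min κ δ₀ / 2) * (-Real.log ω / (2 * (a + 1))))) < 1 ∧
    GeometricIncrements F (localizedSum F S emb) ρ bV (Window γ) (max (Real.exp (Real.log ω / 2)) (Real.exp (-(min κ δ₀ / 2) * (-Real.log ω / (2 * (a + 1)))))) ∧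
    PolLimitsExist F (localizedSum F S emb) ρ bV (Window γ) ∧
    WindowedStepRate F (localizedSum F S emb) ρ bV γ 1 (delta1 δ₀ κ ((M : ℝ) * 4)) θ
      (16 * M₀ * B₃ ^ 2 / r ^ 2 * Real.exp (delta1 δ₀ κ ((M : ℝ) * 4) * ((M : ℝ) * 4) * 3) * K₀ (4 * 2 ^ 4) (2 * 4) * K₁ 4 (δ₀ / 2) * θ) ∧
    KernelStepRate F (localizedSum F S emb) ρ bV γ (delta1 δ₀ κ ((M : ℝ) * 4)) θ
      (16 * M₀ * B₃ ^ 2 / r ^ 2 * Real.exp (delta1 δ₀ κ ((M : ℝ) * 4) * ((M : ℝ) * 4) * 3) * K₀ (4 * 2 ^ 4) (2 * 4) * K₁ 4 (δ₀ / 2)) := by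
  obtain ⟨hC, hval⟩ := chartData_localizedSum_of_holomorphicValue F M S emb ρ bV (Window γ) hr hE₀ ι₁ G₁ U₁ hU₁ hG₁ hrU₁ hf₁ hsup₁ htail₁
  exact u3Letters_localizedSum_of_localTermData F m' M hM S emb ρ bV hκ0 hδ₀ hκ ha hω hω1 hC hval hstab hθ hr hM₀ hB₃ ιc GB GA U hU hGB hGA hrU hfB hfA hsup htail

end Generic

/-! ## A6 smoke: the term-data list is jointly satisfiable — the analytic generic package FIRES at every family of towers WITHOUT TERMS (`idx ≡ ∅`) -/

section Smoke

variable {𝔄 : Type*} [NormedRing 𝔄] [NormedAlgebra ℝ 𝔄] {V : Type*} [NormedAddCommGroup V] [NormedSpace ℝ V] {ι : Type*} [Fintype ι]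

/-- The scalar kernel of an identically vanishing functional vanishes (constant chart, `polTensor_const`). [cite: Balaban1987RG1, (1.20)-(1.21) p.264 (bookkeeping)] -/
theorem polScalar_eq_zero_of_forall_eq_zero {Λ T : Type*} [Fintype Λ] [Fintype T] [DecidableEq Λ] [DecidableEq T] {ℰ : (Λ → T → 𝔄) → ℝ}
    (h : ∀ W, ℰ W = 0) (ρ : V →L[ℝ] 𝔄) (bV : Module.Basis ι ℝ V) (μ : Λ) (x : T) (ν : Λ) (y : T) : polScalar ℰ ρ bV μ x ν y = 0 := by
  have hc : expChart ℰ ρ = fun _ => (0 : ℝ) := funext fun B => h _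
  simp only [polScalar, polComp, hc, Node00.Record8Inhabited.polTensor_const, Finset.sum_const_zero, mul_zero]

/-- A cluster step WITHOUT TERMS (`idx Z = ∅` for every polymer `Z`) has `E^{(k+1)}(X) = 0` for every domain: every activity `H(Z) = Σ_{i ∈ ∅} … = 0`, and the truncated functionals of
the zero activity vanish (`B16Exp198TwoRun.truncatedWeight_zero`). [cite: Balaban1988RG2Cluster, (2.13) p.14 (bookkeeping at the empty index set)] -/
theorem clusterStep_E_eq_zero_of_idx_empty {P : Params} {𝔸 : Type*} {M k : ℕ} (S : Node00.W1.ClusterStep P 𝔸 M k) (h : ∀ Z, S.idx Z = ∅)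
    (g : Fin (k + 1) → ℝ) (φ : CPair P 𝔸) (X : (domSys P M (k + 1)).Dom) : S.E g φ X = 0 := by
  classical
  have hH : ∀ Z, S.H g φ Z = 0 := fun Z => by simp only [Node00.W1.ClusterStep.H, h Z, Finset.sum_empty]
  rw [Node00.W1.ClusterStep.E_eq_locE]
  unfold B13Resummation.locE
  refine Finset.sum_eq_zero fun C _ => ?_
  convert B16Exp198TwoRun.truncatedWeight_zero (inc := TreeLengthTorusGeometry.TTouch (d := P.d) (N := domCount P M (k + 1))) C using 2
  funext Z
  exact hH Z

variable (F : T4Family)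

/-- ★ **A6 — THE TERM-DATA LIST IS JOINTLY SATISFIABLE: the analytic generic package FIRES at every family of towers WITHOUT TERMS.**  For every cube exponent `m′`, every family `S` with
`idx ≡ ∅` (all (2.13) terms `= 0`, `clusterStep_E_eq_zero_of_idx_empty`), every reading maps `emb`, representation `ρ`, basis `bV`, window radius `γ` and rate `θ ≥ 0`, ALL hypotheses of
`u3Letters_localizedSum_of_analyticLocalTermData` hold with ANY complex normed space `Ec` as complexified space, `ι := 0`, `G := 0`, `U := univ`, `r := 1`, `E₀ = B₃ = M₀ = A := 0`, `a := 0`,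
`ω := ½`, `κ := 4κ₀(64,8) + 4`, `δ₀ := 1`, `G_B = G_A := 0` — so the four letters hold for `localizedSum F S emb` (degenerate, declared: the zero kernels).  What this certifies: the
≈ 25 displayed binders of the package are not jointly contradictory (no vacuous antecedent); what it does NOT: any estimate at Bałaban's towers. [cite: Balaban1987RG1, (1.20)-(1.21) p.264 (bookkeeping at the zero terms)] -/
theorem u3Letters_localizedSum_of_analyticLocalTermData_fires_emptyTowers (Ec : Type*) [NormedAddCommGroup Ec] [NormedSpace ℂ Ec] (m' : ℕ) {𝔸 : Type*}
    [NeZero (F.L ^ m')] (S : (K : ℕ) → ClusterTower (F.P K) 𝔸 (F.L ^ m')) (hS : ∀ (K k : ℕ) (Z : (domSys (F.P K) (F.L ^ m') (k + 1)).Dom), ((S K) k).idx Z = ∅)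
    (emb : ReadingMaps F 𝔄 𝔸) (ρ : V →L[ℝ] 𝔄) (bV : Module.Basis ι ℝ V) (γ : ℝ) {θ : ℝ} (hθ : 0 ≤ θ) :
    max (Real.exp (Real.log (1 / 2 : ℝ) / 2)) (Real.exp (-(min (4 * kappa₀ (4 * 2 ^ 4) (2 * 4) + 4) 1 / 2) * (-Real.log (1 / 2 : ℝ) / (2 * (0 + 1))))) < 1 ∧
    GeometricIncrements F (localizedSum F S emb) ρ bV (Window γ)
      (max (Real.exp (Real.log (1 / 2 : ℝ) / 2)) (Real.exp (-(min (4 * kappa₀ (4 * 2 ^ 4) (2 * 4) + 4) 1 / 2) * (-Real.log (1 / 2 : ℝ) / (2 * (0 + 1)))))) ∧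
    PolLimitsExist F (localizedSum F S emb) ρ bV (Window γ) ∧
    WindowedStepRate F (localizedSum F S emb) ρ bV γ 1 (delta1 1 (4 * kappa₀ (4 * 2 ^ 4) (2 * 4) + 4) (((F.L ^ m' : ℕ) : ℝ) * 4)) θ
      (16 * 0 * 0 ^ 2 / 1 ^ 2 * Real.exp (delta1 1 (4 * kappa₀ (4 * 2 ^ 4) (2 * 4) + 4) (((F.L ^ m' : ℕ) : ℝ) * 4) * (((F.L ^ m' : ℕ) : ℝ) * 4) * 3) *
        K₀ (4 * 2 ^ 4) (2 * 4) * K₁ 4 (1 / 2) * θ) ∧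
    KernelStepRate F (localizedSum F S emb) ρ bV γ (delta1 1 (4 * kappa₀ (4 * 2 ^ 4) (2 * 4) + 4) (((F.L ^ m' : ℕ) : ℝ) * 4)) θ
      (16 * 0 * 0 ^ 2 / 1 ^ 2 * Real.exp (delta1 1 (4 * kappa₀ (4 * 2 ^ 4) (2 * 4) + 4) (((F.L ^ m' : ℕ) : ℝ) * 4) * (((F.L ^ m' : ℕ) : ℝ) * 4) * 3) *
        K₀ (4 * 2 ^ 4) (2 * 4) * K₁ 4 (1 / 2)) := by
  have hk0 : 0 ≤ kappa₀ (4 * 2 ^ 4) (2 * 4) := B12TreeDecay.kappa₀_nonneg (by norm_num) _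
  have hE : ∀ (K k : ℕ) (hist : Fin (k + 1) → ℝ) (φ : CPair (F.P K) 𝔸) (X : (domSys (F.P K) (F.L ^ m') (k + 1)).Dom), ((S K) k).E hist φ X = 0 :=
    fun K k hist φ X => clusterStep_E_eq_zero_of_idx_empty _ (hS K k) _ _ _
  refine u3Letters_localizedSum_of_analyticLocalTermData F m' (F.L ^ m') rfl S emb ρ bV (Ec := Ec) (by linarith) one_pos (by linarith) le_rfl (by norm_num) (by norm_num)
    one_pos le_rfl le_rfl (fun _ _ _ _ => 0) (fun _ _ _ _ _ => 0) (fun _ _ _ _ => Set.univ) (fun _ _ _ _ => isOpen_univ)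
    (fun _ _ _ _ => differentiableOn_const 0) (fun _ _ _ _ => Set.subset_univ _)
    (fun g _ k K X B => by simp [B12PolarizationTensor120.expChart_apply, hE])
    (fun g _ k K X ζ _ => by simp)
    (fun g k K X l t c => by intro e; rw [zero_apply, norm_zero, zero_mul])
    (fun g _ k μ ν z => ⟨0, 0, le_rfl, fun R _ K _ => ?_⟩) hθ le_rfl
    (fun _ _ _ _ => 0) (fun _ _ _ _ _ => 0) (fun _ _ _ _ _ => 0) (fun _ _ _ _ => Set.univ) (fun _ _ _ _ => isOpen_univ)
    (fun _ _ _ _ => differentiableOn_const 0) (fun _ _ _ _ => differentiableOn_const 0) (fun _ _ _ _ => Set.subset_univ _)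
    (fun k w _ K X B => by simp [B12PolarizationTensor120.expChart_apply, hE])
    (fun k w _ K X B => by simp [B12PolarizationTensor120.expChart_apply, hE])
    (fun k w _ K X ζ _ => by simp)
    (fun k w K X l t c => by intro e; rw [zero_apply, norm_zero, zero_mul])
  have h0 : ∀ (K : ℕ) (s : Finset ((domSys (F.P K) (F.L ^ m') (k + 1)).Dom)),
      (∑ X ∈ s, polScalar (fun W' => (((S K) k).E (histPrefix g k) (emb K k W') X).re) ρ bV (Fin.cast (F.P_d K).symm μ) (siteOfInt F K (k + 1) z)
        (Fin.cast (F.P_d K).symm ν) (siteOfInt F K (k + 1) 0)) = 0 := fun K s =>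
    Finset.sum_eq_zero fun X _ => polScalar_eq_zero_of_forall_eq_zero (fun W => by rw [hE, Complex.zero_re]) ρ bV _ _ _ _
  rw [h0, h0, sub_zero, abs_zero]
  positivity

end Smoke

end YMDAG.N18.U3LettersPackage

end
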